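import Mathlib
import Summits.Ventures.PercRepro.PuncturedLYMCapGuard

/-!
# PercRepro — THE VALUE-BLOCK PIPELINE WITH A PATH-INDEXED TABLE
(p10, gen 43)

For `m ≥ 5` two paths of the value-block recursion can reach the same stage `(w, l, K')` with different masses and
discounts (paper proofs/P10-PEEL-g42.md §5(d)), so a table reading only the stage cannot serve them.  `CapOKp` /
`CountOKp` are `CapOKg` / `CountOKg` with the PATH `σ` — the list of block sizes peeled so far — handed to the table;
the recursion appends the class it takes.  `hasFlow_cap_of_okp`, `capOKp_of_countOKp`, `puncturedNMP_of_countOKp` are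
the guarded pipeline of PuncturedLYMCapGuard with the path threaded through: (SP) of `k` disjoint `m`-sets on `n`
points from `CountOKp` at the empty path and `(k, n − m·k)`, for every `n`.  Nothing here asserts (SP).
-/

namespace PercRepro.PuncturedLYM.Split.Peel

open Finset

variable {α : Type} [DecidableEq α]

/-- The guarded admissibility on sets with the path handed to the table. -/
def CapOKp (m : ℕ) (βt : List ℕ → Finset α → Finset (Finset α) → ℕ → ℕ → ℚ → ℚ → ℕ → ℚ) :
    List ℕ → ℕ → Finset α → Finset (Finset α) → ℕ → ℚ → ℚ → ℚ → Prop
  | _, 0, S, 𝒞, l, a, γ, R => l ≤ (S \ blockUnion 𝒞).card →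
      R = a * (((S \ blockUnion 𝒞).card - l : ℕ) : ℚ) / ((l : ℚ) + 1) + γ * 𝒞.card
  | σ, w + 1, S, 𝒞, l, a, γ, R =>
      βt σ S 𝒞 l (w + 1) a γ 0 = 0 ∧ (∀ c, 0 ≤ βt σ S 𝒞 l (w + 1) a γ c ∧ βt σ S 𝒞 l (w + 1) a γ c ≤ 1) ∧
      (∀ c, (w + 1) * c = l + 1 → βt σ S 𝒞 l (w + 1) a γ c = 1) ∧
      ∀ B : Finset (Finset α), B ⊆ 𝒞 → (w + 1) * B.card ≤ l →
        l - (w + 1) * B.card ≤ (S \ blockUnion 𝒞).card + (𝒞.card - B.card) * w →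
        CapOKp m βt (σ ++ [B.card]) w (S \ blockUnion B) (𝒞 \ B) (l - (w + 1) * B.card)
          (a * (1 - βt σ S 𝒞 l (w + 1) a γ B.card))
          (((m : ℚ) - (w + 1 : ℕ) + 1) * a * βt σ S 𝒞 l (w + 1) a γ (B.card + 1) / (((B.card : ℚ) + 1) * (w + 1 : ℕ)))
          (R - γ * B.card)

/-- **THE CAP FLOW FROM A PATH-INDEXED GUARDED-ADMISSIBLE TABLE.** -/
theorem hasFlow_cap_of_okp {m : ℕ} (βt : List ℕ → Finset α → Finset (Finset α) → ℕ → ℕ → ℚ → ℚ → ℕ → ℚ) :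
    ∀ (w : ℕ) (σ : List ℕ) (S : Finset α) (𝒞 : Finset (Finset α)) (l : ℕ) (a γ R : ℚ),
      (∀ C ∈ 𝒞, C ⊆ S) → (∀ C ∈ 𝒞, C.card = m) → (∀ C ∈ 𝒞, ∀ C' ∈ 𝒞, C ≠ C' → Disjoint C C') →
      w < m → 0 ≤ a → CapOKp m βt σ w S 𝒞 l a γ R →
      HasFlow S l (rowsCap S l 𝒞 w) (fun X => R - γ * rcount 𝒞 w X)
        (fun Y => if ∀ C ∈ 𝒞, (Y ∩ C).card ≤ w then a else 0) := by
  intro w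
  induction w with
  | zero =>
    intro σ S 𝒞 l a γ R _ _ _ _ ha hok
    simp only [CapOKp] at hok
    by_cases hl : l ≤ (S \ blockUnion 𝒞).card
    · refine ⟨cap0Weight S 𝒞 l a, ?_⟩
      rw [hok hl]
      exact isFlow_cap0 ha
    · refine ⟨fun _ _ => 0, isFlow_zero_of_no_rows ?_ _ _⟩
      apply rowsCap_eq_empty_of_lt
      rw [Nat.mul_zero, Nat.add_zero]
      omega
  | succ w ih =>
    intro σ S 𝒞 l a γ R h𝒞S hcard hdisj hwm ha hok
    obtain ⟨hβ0, hβ, hβtop, hinnerOK⟩ := hok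
    have hinner : ∀ B : Finset (Finset α), B ⊆ 𝒞 ∧ (w + 1) * B.card ≤ l →
        HasFlow (S \ blockUnion B) (l - (w + 1) * B.card)
          (rowsCap (S \ blockUnion B) (l - (w + 1) * B.card) (𝒞 \ B) w)
          (fun X' => (R - γ * B.card) - (((m : ℚ) - (w + 1 : ℕ) + 1) * a * βt σ S 𝒞 l (w + 1) a γ (B.card + 1)
            / (((B.card : ℚ) + 1) * (w + 1 : ℕ))) * rcount (𝒞 \ B) w X')
          (fun Y' => if ∀ C ∈ 𝒞 \ B, (Y' ∩ C).card ≤ w then a * (1 - βt σ S 𝒞 l (w + 1) a γ B.card) else 0) := by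
      rintro B ⟨hB, hBl⟩
      by_cases hrows : l - (w + 1) * B.card ≤ (S \ blockUnion 𝒞).card + (𝒞.card - B.card) * w
      · apply ih (σ ++ [B.card])
        · intro C hC
          obtain ⟨hC𝒞, hCB⟩ := mem_sdiff.1 hC
          exact subset_sdiff.2 ⟨h𝒞S C hC𝒞, disjoint_blockUnion_of_notMem hdisj hB hC𝒞 hCB⟩
        · exact fun C hC => hcard C (mem_sdiff.1 hC).1
        · exact fun C hC C' hC' hne => hdisj C (mem_sdiff.1 hC).1 C' (mem_sdiff.1 hC').1 hne
        · omega
        · exact mul_nonneg ha (by linarith [(hβ B.card).2])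
        · exact hinnerOK B hB hBl hrows
      · refine ⟨fun _ _ => 0, isFlow_zero_of_no_rows ?_ _ _⟩
        apply rowsCap_eq_empty_of_lt
        rw [sdiff_blockUnion_sdiff hB, card_sdiff_of_subset hB]
        omega
    choose w' hw' using hinner
    let w'' : Finset (Finset α) → Finset α → Finset α → ℚ := fun B =>
      if h : B ⊆ 𝒞 ∧ (w + 1) * B.card ≤ l then w' B h else fun _ _ => 0
    have hw''nn : ∀ B X Y, 0 ≤ w'' B X Y := by
      intro B X Y
      simp only [w'']
      split_ifs with h
      · exact (hw' B h).nonneg X Y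
      · exact le_refl 0
    refine ⟨capWeight 𝒞 (w + 1) a (βt σ S 𝒞 l (w + 1) a γ) w'', ?_⟩
    have hflow := isFlow_capPeel (S := S) h𝒞S hcard hdisj (w := w + 1) (by omega) hwm (l := l) ha
      (β := βt σ S 𝒞 l (w + 1) a γ) hβ0 hβ hβtop (γ := γ) (R := R)
      (γ' := fun c => ((m : ℚ) - (w + 1 : ℕ) + 1) * a * βt σ S 𝒞 l (w + 1) a γ (c + 1) / (((c : ℚ) + 1) * (w + 1 : ℕ)))
      (R' := fun c => R - γ * c) (fun c => by push_cast; ring) (fun c => rfl) (w' := w'') hw''nn ?_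
    · exact hflow
    · intro B hB hBl
      have hh : B ⊆ 𝒞 ∧ (w + 1) * B.card ≤ l := ⟨hB, hBl⟩
      have heq : w'' B = w' B hh := by simp only [w'', dif_pos hh]
      rw [heq]
      have := hw' B hh
      simpa using this

/-- A path-indexed table on counts read as a table on sets. -/
def tableOfCountsP (tab : List ℕ → ℕ → ℕ → ℕ → ℕ → ℚ → ℚ → ℕ → ℚ) :
    List ℕ → Finset α → Finset (Finset α) → ℕ → ℕ → ℚ → ℚ → ℕ → ℚ :=
  fun σ S 𝒞 l w a γ c => tab σ 𝒞.card (S \ blockUnion 𝒞).card l w a γ c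

/-- The guarded admissibility on counts with the path handed to the table. -/
def CountOKp (m : ℕ) (tab : List ℕ → ℕ → ℕ → ℕ → ℕ → ℚ → ℚ → ℕ → ℚ) :
    List ℕ → ℕ → ℕ → ℕ → ℕ → ℚ → ℚ → ℚ → Prop
  | _, 0, K, f, l, a, γ, R => l ≤ f → R = a * ((f - l : ℕ) : ℚ) / ((l : ℚ) + 1) + γ * K
  | σ, w + 1, K, f, l, a, γ, R =>
      tab σ K f l (w + 1) a γ 0 = 0 ∧ (∀ c, 0 ≤ tab σ K f l (w + 1) a γ c ∧ tab σ K f l (w + 1) a γ c ≤ 1) ∧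
      (∀ c, (w + 1) * c = l + 1 → tab σ K f l (w + 1) a γ c = 1) ∧
      ∀ c, c ≤ K → (w + 1) * c ≤ l → l - (w + 1) * c ≤ f + (K - c) * w →
        CountOKp m tab (σ ++ [c]) w (K - c) f (l - (w + 1) * c) (a * (1 - tab σ K f l (w + 1) a γ c))
          (((m : ℚ) - (w + 1 : ℕ) + 1) * a * tab σ K f l (w + 1) a γ (c + 1) / (((c : ℚ) + 1) * (w + 1 : ℕ)))
          (R - γ * c)

/-- **PATH-INDEXED GUARDED ADMISSIBILITY ON SETS FROM THE ONE ON COUNTS.** -/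
theorem capOKp_of_countOKp {m : ℕ} (tab : List ℕ → ℕ → ℕ → ℕ → ℕ → ℚ → ℚ → ℕ → ℚ) :
    ∀ (w : ℕ) (σ : List ℕ) (S : Finset α) (𝒞 : Finset (Finset α)) (l : ℕ) (a γ R : ℚ),
      (∀ C ∈ 𝒞, C ⊆ S) → (∀ C ∈ 𝒞, C.card = m) → (∀ C ∈ 𝒞, ∀ C' ∈ 𝒞, C ≠ C' → Disjoint C C') →
      CountOKp m tab σ w 𝒞.card (S \ blockUnion 𝒞).card l a γ R →
      CapOKp m (tableOfCountsP tab) σ w S 𝒞 l a γ R := by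
  intro w
  induction w with
  | zero =>
    intro σ S 𝒞 l a γ R _ _ _ hok
    exact hok
  | succ w ih =>
    intro σ S 𝒞 l a γ R h𝒞S hcard hdisj hok
    obtain ⟨h0, hβ, htop, hinner⟩ := hok
    refine ⟨h0, hβ, htop, ?_⟩
    intro B hB hBl hrows
    have hcardB : (𝒞 \ B).card = 𝒞.card - B.card := card_sdiff_of_subset hB
    have hfree : ((S \ blockUnion B) \ blockUnion (𝒞 \ B)).card = (S \ blockUnion 𝒞).card := by
      rw [sdiff_blockUnion_sdiff hB]
    have hcount := hinner B.card (card_le_card hB) hBl hrows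
    exact ih (σ ++ [B.card]) (S \ blockUnion B) (𝒞 \ B) (l - (w + 1) * B.card)
      (a * (1 - tab σ 𝒞.card (S \ blockUnion 𝒞).card l (w + 1) a γ B.card))
      (((m : ℚ) - (w + 1 : ℕ) + 1) * a * tab σ 𝒞.card (S \ blockUnion 𝒞).card l (w + 1) a γ (B.card + 1)
        / (((B.card : ℚ) + 1) * (w + 1 : ℕ)))
      (R - γ * B.card)
      (fun C hC => subset_sdiff.2 ⟨h𝒞S C (mem_sdiff.1 hC).1,
        disjoint_blockUnion_of_notMem hdisj hB (mem_sdiff.1 hC).1 (mem_sdiff.1 hC).2⟩)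
      (fun C hC => hcard C (mem_sdiff.1 hC).1)
      (fun C hC C' hC' hne => hdisj C (mem_sdiff.1 hC).1 C' (mem_sdiff.1 hC').1 hne)
      (by rw [hcardB, hfree]; exact hcount)

/-- **(SP) OF A PAIRWISE DISJOINT FAMILY FROM PATH-INDEXED GUARDED ADMISSIBILITY ON COUNTS — FOR EVERY `n`.** -/
theorem puncturedNMP_of_countOKp [Fintype α] {m : ℕ} (tab : List ℕ → ℕ → ℕ → ℕ → ℕ → ℚ → ℚ → ℕ → ℚ)
    {k : ℕ} (C : Fin k → Finset α) (hm : 0 < m) (hcard : ∀ i, (C i).card = m)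
    (hdisj : ∀ i j, i ≠ j → Disjoint (C i) (C j)) {l : ℕ} (hl : l + 1 < 2 * m) {R : ℚ}
    (hok : CountOKp m tab [] (m - 1) k (Fintype.card α - m * k) l 1 (1 / (m : ℚ)) R) :
    PuncturedNMP l ((univ : Finset (Fin k)).biUnion (fun i => upLevel l (C i))) := by
  set 𝒞 := (univ : Finset (Fin k)).image C with h𝒞
  have hinj : Function.Injective C := by
    intro i j hij
    by_contra hne
    have hd := hdisj i j hne
    rw [hij, disjoint_self] at hd
    have := hcard j
    rw [hd] at this
    simp only [Finset.bot_eq_empty, card_empty] at this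
    omega
  have hcard' : ∀ C' ∈ 𝒞, C'.card = m := by
    intro C' hC'
    obtain ⟨i, _, rfl⟩ := mem_image.1 hC'
    exact hcard i
  have hdisj' : ∀ C' ∈ 𝒞, ∀ C'' ∈ 𝒞, C' ≠ C'' → Disjoint C' C'' := by
    intro C' hC' C'' hC'' hne
    obtain ⟨i, _, rfl⟩ := mem_image.1 hC'
    obtain ⟨j, _, rfl⟩ := mem_image.1 hC''
    exact hdisj i j (fun h => hne (h ▸ rfl))
  have hK : 𝒞.card = k := by
    rw [h𝒞, card_image_of_injective _ hinj, card_univ, Fintype.card_fin]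
  have hf : ((univ : Finset α) \ blockUnion 𝒞).card = Fintype.card α - m * k := by
    rw [card_sdiff_of_subset (subset_univ _), card_univ]
    congr 1
    unfold blockUnion
    rw [card_biUnion]
    · rw [sum_congr rfl (fun C' hC' => show (id C').card = m from hcard' C' hC'), sum_const, hK, smul_eq_mul,
        Nat.mul_comm]
    · intro C' hC' C'' hC'' hne
      exact hdisj' C' hC' C'' hC'' hne
  have hcap := hasFlow_cap_of_okp (tableOfCountsP tab) (m - 1) [] univ 𝒞 l 1 (1 / (m : ℚ)) R
    (fun _ _ => subset_univ _) hcard' hdisj' (by omega) zero_le_one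
    (capOKp_of_countOKp tab (m - 1) [] univ 𝒞 l 1 (1 / (m : ℚ)) R (fun _ _ => subset_univ _) hcard' hdisj'
      (by rw [hK, hf]; exact hok))
  have hflow := hasFlow_sp_of_cap (fun _ _ => subset_univ _) hm hcard' hdisj' hl hcap
  obtain ⟨w, hw⟩ := hflow
  have hrows : rowsOf univ l 𝒞 = punctured l ((univ : Finset (Fin k)).biUnion (fun i => upLevel l (C i))) :=
    rowsOf_univ_eq_punctured C
  have hcolsU : cols univ l = levelAbove α l := rfl
  have hcount := sum_row_eq_sum_col (P := rowsOf univ l 𝒞)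
    (fun X hX => mem_powersetCard.2 ⟨(mem_rowsOf.1 hX).1, (mem_rowsOf.1 hX).2.1⟩) hw
  have hcol1 : ∀ Y ∈ cols univ l, colMass 𝒞 1 Y = 1 := by
    intro Y _; unfold colMass; split_ifs <;> rfl
  rw [sum_congr rfl hcol1] at hcount
  simp only [sum_const, nsmul_eq_mul, mul_one] at hcount
  rw [hcolsU] at hcount
  rcases Nat.eq_zero_or_pos (levelAbove α l).card with hY0 | hYpos
  · intro 𝒜 _
    rw [hY0, Nat.mul_zero]
    exact Nat.zero_le _
  · apply puncturedNMP_of_hasFlow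
    rw [← hrows]
    have hYq : (0 : ℚ) < (levelAbove α l).card := by exact_mod_cast hYpos
    have hPpos : (0 : ℚ) < (rowsOf univ l 𝒞).card := by
      by_contra h
      have h' : ((rowsOf univ l 𝒞).card : ℚ) = 0 := le_antisymm (not_lt.1 h) (Nat.cast_nonneg _)
      rw [h', zero_mul] at hcount
      exact hYq.ne' hcount.symm
    refine ⟨fun X Y => w X Y / (levelAbove α l).card, fun X Y => div_nonneg (hw.nonneg X Y) hYq.le, ?_, ?_⟩
    · intro X hX
      rw [← sum_div, hw.row X hX, div_eq_div_iff hYq.ne' hPpos.ne', one_mul, mul_comm]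
      exact hcount
    · intro Y hY
      rw [← sum_div, hw.col Y hY, hcol1 Y hY]

end PercRepro.PuncturedLYM.Split.Peel
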